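import Literature.Geometry.Lorentzian.Stationary
import Literature.Geometry.Lorentzian.KerrStarCoord
import Literature.Geometry.Lorentzian.KerrLeafEnergyComparison
import Literature.Geometry.Lorentzian.ModelData
import Literature.Geometry.Lorentzian.AsymptoticallyFlatChart
import Literature.Geometry.Manifold.TranslationFlow
import HarnessLib

/-!
# The Kerr black hole as a `StationaryAFBlackHole` (definition request D3 of the Belt–Liouville route)

Family `gr`; namespaces `Literature.Geometry.Lorentzian.Kerr` and `Literature.Geometry.Lorentzian.AFEnd`.

`Stationary.lean` formalises the hypotheses of the black-hole uniqueness theorem as the structure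
`StationaryAFBlackHole` (a `4`-dimensional spacetime, a spacelike slice `X` with induced data `D`
and an asymptotically flat end `e`, and a complete Killing field `X₀` future-directed timelike on
`M_ext = ⋃ₜ φₜ(embed(e.far (e.R + 1)))`; Chruściel–Costa, Astérisque 321 (2008), §2.1). This file
**instantiates it on the Kerr family** in the ingoing Kerr–Schild chart of `KerrSchild.lean` /
`KerrData.lean` (Dafermos–Rodnianski arXiv:0811.0354, §5.1; O'Neill 1995, Ch. 2):

* `Kerr.stationaryAFBlackHoleOn M a r₀ hM hAF : StationaryAFBlackHole` — the chart
  `Kerr.region a r₀ = {r > max r₀ 0}` (`Kerr.spacetime M a r₀ hM`), the slice `Kerr.slice a r₀`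
  (`{t* = 0}`) with the Kerr data `Kerr.data M a r₀ hM`, embedding `Kerr.sliceEmbed` and future unit
  normal `Kerr.sliceNormal`, the **far end** `Kerr.farEnd M a r₀ hM = {‖y‖ > R_T}`,
  `R_T = Kerr.stationaryRadius M a r₀ = Kerr.afRadius a r₀ + 2M` (beyond which `∂_{t*}` is timelike),
  and the Killing field `Kerr.stationaryField = ∂_{t*}`;
* `Kerr.stationaryAFBlackHole M a δ hMa hAF` — the requested sub-extremal, horizon-penetrating
  instance `r₀ = r₊ − δ` (`|a| < M`; intended `0 < δ < r₊ − r₋`).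

**Every field of the structure is proved**, from:

* `AFEnd.IsAsymptoticallyFlat.of_dataChartExt_eventuallyEq` — asymptotic flatness of order `α`
  only depends on the end structure far out (two end structures whose extended inverse charts
  agree locally far out have the same chart components `h_ij`, `k_ij` there,
  `AFEnd.hCoeff_eq_of_dataChartExt_eventuallyEq`), whence `Kerr.isAsymptoticallyFlat_farEnd`
  from the named fact `Kerr.isAsymptoticallyFlat_data` (stated for `Kerr.afEnd`; hypothesis `hAF`);
* `Kerr.timeCurve`, `Kerr.isMIntegralCurve_timeCurve`, `Kerr.eq_timeCurve_of_isMIntegralCurve`,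
  `Kerr.isCompleteVectorField_stationaryField`, `Kerr.mem_stationaryOrbit_stationaryField_iff` —
  the integral curves of `∂_{t*}` are exactly the time translations `t ↦ x + t ∂_{t*}` (existence by
  `OpensChart.hasMFDerivAt_codRestrict`, uniqueness by
  `Literature.Geometry.Manifold.apply_integralCurve_eq_add_smul` applied to the inclusion
  `Kerr.region a r₀ ⊆ E4`), so `∂_{t*}` is complete and stationary orbits are unions of translates;
* `Kerr.two_mul_scalarH_lt_one`, `Kerr.isTimelike_stationaryField_timeCurve` — beyond `R_T`,
  `r > 2M`, `2H ≤ 2M/r < 1` and `g(∂_{t*}, ∂_{t*}) = −1 + 2H < 0`, `g(V, ∂_{t*}) = −1 < 0`;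
* `Kerr.isKillingField_stationaryField_smoothMetric` — `∂_{t*}` is Killing for the `C^∞` Kerr
  metric (the `C^∞` twin of `Kerr.isKillingField_stationaryField_holds`, `KerrSchildCoord.lean`);
* `Kerr.isSmoothEmbedding_sliceEmbed_holds` — **discharge of the named fact
  `Kerr.isSmoothEmbedding_sliceEmbed`** (`KerrData.lean`): `y ↦ (0, y)` is an immersion in
  Mathlib's chart sense (`Kerr.isImmersion_sliceEmbed`, as `Minkowski.isImmersion_sliceEmbed` of
  `ModelData.lean`) and a topological embedding (`Kerr.isEmbedding_sliceEmbed`);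
* the discharges `Kerr.isFutureUnitNormal_sliceNormal_holds` (`KerrHyperboloidalLeaves.lean`) and
  the `rfl` identities `embed^* g = h`, `K_ν = k` of `Kerr.data`.

API: the projections are `rfl` (`stationaryAFBlackHoleOn_toSpacetime`, `_killing`, `_embed`, `_D`,
`_e`, `_normal`); **`M_ext = {(t*, y) | ‖y‖ > R_T + 1}`** (`Kerr.mem_Mext_stationaryAFBlackHoleOn_iff`),
`r > 2M ≥ r₊` on `M_ext` (`Kerr.two_mul_lt_radius_of_mem_Mext`, `Kerr.rPlus_lt_radius_of_mem_Mext`),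
`M_ext` is invariant under the flow (`Kerr.timeCurve_mem_Mext`) and **`M_ext ⊆ ⟨⟨M_ext⟩⟩`**
(`Kerr.Mext_subset_doc`: the orbits of `∂_{t*}` through `M_ext` are timelike curves), so the domain
of outer communications of the Kerr black hole is nonempty.

Not provided here (they are theorems about the causal structure / geodesic flow of Kerr, requested
by the same item as follow-ups): the identifications `doc = {r > r₊}`, `𝓔⁺ = {r = r₊}`, and the
verification of the hypotheses of `SmoothHawkingRigidity` (route Belt–Liouville) for the Hawking
field `Kerr.hawkingField`.

## Hypotheses

`0 ≤ M`; the instance hypotheses `[Kerr.Facts]`, `[Kerr.SliceFacts]` of `Kerr.spacetime` /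
`Kerr.data` (`KerrSchild.lean`, `KerrData.lean`); the named fact `Kerr.isAsymptoticallyFlat_data`
(`hAF`). No new named fact is introduced.

## References

* M. Dafermos, I. Rodnianski, *Lectures on black holes and linear waves*, arXiv:0811.0354, §5.1
  (ingoing Kerr coordinates `(t*, r, θ, φ*)`, the slices `{t* = c}`, `∂_{t*}` Killing).
* B. O'Neill, *The geometry of Kerr black holes*, A K Peters 1995, Ch. 2, §§2.2–2.5 (Killing
  fields `∂_t`, `∂_φ`; `r_±`; ergosphere; Boyer–Lindquist blocks).
* P. T. Chruściel, J. L. Costa, *On uniqueness of stationary vacuum black holes*, Astérisque 321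
  (2008), §2.1–2.2 ((2.1) `M_ext = ⋃ₜ φₜ(Σ_ext)`, (2.2) `⟨⟨M_ext⟩⟩`), Thm. 1.3.
* R. Bartnik, *The mass of an asymptotically flat manifold*, CPAM 39 (1986), §1, Def. 2.1.
* B. O'Neill, *Semi-Riemannian geometry*, Academic Press 1983, Ch. 1 (integral curves), Ch. 9,
  Prop. 9.25 (Killing fields).
* S. W. Hawking, G. F. R. Ellis, *The large scale structure of space-time*, CUP 1973, §2.3
  (immersions, imbeddings).
* M. Visser, *The Kerr spacetime: a brief introduction*, arXiv:0706.0622, (32)–(35).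
-/

noncomputable section

open Bundle Set Filter TopologicalSpace Manifold Bornology
open scoped ContDiff Topology

namespace Literature.Geometry.Lorentzian

/-! ### Asymptotic flatness does not depend on the inner radius of an inclusion end -/

namespace AFEnd

variable {X : Type} [TopologicalSpace X] [ChartedSpace E3 X] [IsManifold (𝓡 3) ∞ X]

/-- Two end structures whose extended inverse charts `dataChartExt` agree near a point `z` of both
exterior regions have the same metric components `h_ij(z)` there (the components are the pullback
of `h` along the inverse chart, whose value and differential at `z` are local). Bartnik, CPAM 39
(1986), §1, (1.3). [cite: Bartnik1986, §1 (1.3)] -/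
theorem hCoeff_eq_of_dataChartExt_eventuallyEq {e e' : AFEnd X} (D : InitialDataSet (𝓡 3) X)
    {z : E3} (hz : e.R < ‖z‖) (hz' : e'.R < ‖z‖)
    (h : e.dataChartExt =ᶠ[𝓝 z] e'.dataChartExt) : hCoeff e D z = hCoeff e' D z := by
  have h1 : e.dataChart ⟨z, hz⟩ = e'.dataChart ⟨z, hz'⟩ := by
    rw [← e.dataChartExt_of_lt hz, ← e'.dataChartExt_of_lt hz']
    exact h.eq_of_nhds
  have h2 : mfderiv 𝓘(ℝ, E3) (𝓡 3) e.dataChartExt z = mfderiv 𝓘(ℝ, E3) (𝓡 3) e'.dataChartExt z :=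
    h.mfderiv_eq
  have h3 : ∀ u : E3, mfderiv (𝓡 3) (𝓡 3) e.dataChart ⟨z, hz⟩ u =
      mfderiv (𝓡 3) (𝓡 3) e'.dataChart ⟨z, hz'⟩ u := fun u ↦ by
    rw [e.mfderiv_dataChart_eq, e'.mfderiv_dataChart_eq]
    exact DFunLike.congr_fun h2 u
  have key : ∀ p q : X, p = q → ∀ A B : E3, D.h.inner p A B = D.h.inner q A B := by
    rintro p q rfl A B
    rfl
  rw [hCoeff_of_lt D hz, hCoeff_of_lt D hz']
  refine ContinuousLinearMap.ext fun u ↦ ContinuousLinearMap.ext fun v ↦ ?_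
  change D.h.inner (e.dataChart ⟨z, hz⟩) (mfderiv (𝓡 3) (𝓡 3) e.dataChart ⟨z, hz⟩ u)
      (mfderiv (𝓡 3) (𝓡 3) e.dataChart ⟨z, hz⟩ v) =
    D.h.inner (e'.dataChart ⟨z, hz'⟩) (mfderiv (𝓡 3) (𝓡 3) e'.dataChart ⟨z, hz'⟩ u)
      (mfderiv (𝓡 3) (𝓡 3) e'.dataChart ⟨z, hz'⟩ v)
  rw [h3 u, h3 v]
  exact key _ _ h1 _ _

/-- Two end structures whose extended inverse charts agree near a point `z` of both exterior
regions have the same components `k_ij(z)` of the second fundamental form there.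
Christodoulou–Klainerman 1993, (1.0.9); Bartnik 1986, §1. [cite: Bartnik1986, §1] -/
theorem kCoeff_eq_of_dataChartExt_eventuallyEq {e e' : AFEnd X} (D : InitialDataSet (𝓡 3) X)
    {z : E3} (hz : e.R < ‖z‖) (hz' : e'.R < ‖z‖)
    (h : e.dataChartExt =ᶠ[𝓝 z] e'.dataChartExt) : kCoeff e D z = kCoeff e' D z := by
  have h1 : e.dataChart ⟨z, hz⟩ = e'.dataChart ⟨z, hz'⟩ := by
    rw [← e.dataChartExt_of_lt hz, ← e'.dataChartExt_of_lt hz']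
    exact h.eq_of_nhds
  have h2 : mfderiv 𝓘(ℝ, E3) (𝓡 3) e.dataChartExt z = mfderiv 𝓘(ℝ, E3) (𝓡 3) e'.dataChartExt z :=
    h.mfderiv_eq
  have h3 : ∀ u : E3, mfderiv (𝓡 3) (𝓡 3) e.dataChart ⟨z, hz⟩ u =
      mfderiv (𝓡 3) (𝓡 3) e'.dataChart ⟨z, hz'⟩ u := fun u ↦ by
    rw [e.mfderiv_dataChart_eq, e'.mfderiv_dataChart_eq]
    exact DFunLike.congr_fun h2 u
  have key : ∀ p q : X, p = q → ∀ A B : E3, D.k p A B = D.k q A B := by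
    rintro p q rfl A B
    rfl
  rw [kCoeff_of_lt D hz, kCoeff_of_lt D hz']
  refine ContinuousLinearMap.ext fun u ↦ ContinuousLinearMap.ext fun v ↦ ?_
  change D.k (e.dataChart ⟨z, hz⟩) (mfderiv (𝓡 3) (𝓡 3) e.dataChart ⟨z, hz⟩ u)
      (mfderiv (𝓡 3) (𝓡 3) e.dataChart ⟨z, hz⟩ v) =
    D.k (e'.dataChart ⟨z, hz'⟩) (mfderiv (𝓡 3) (𝓡 3) e'.dataChart ⟨z, hz'⟩ u)
      (mfderiv (𝓡 3) (𝓡 3) e'.dataChart ⟨z, hz'⟩ v)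
  rw [h3 u, h3 v]
  exact key _ _ h1 _ _

/-- **Asymptotic flatness is a property of the end, not of the end structure's inner radius**:
if the extended inverse charts of two end structures `e`, `e'` of `X` agree locally far out
(eventually along `Bornology.cobounded E3`, in a neighbourhood of each point), then the chart
components `h_ij`, `k_ij` of any data `D` agree on an exterior region, so do all their
derivatives, and `D` is asymptotically flat of order `α` for `e'` as soon as it is for `e`.
Bartnik, CPAM 39 (1986), §1 (the decay conditions only involve `E_R` for `R` large) and
Def. 2.1. [cite: Bartnik1986, §1 and Def. 2.1] -/
theorem IsAsymptoticallyFlat.of_dataChartExt_eventuallyEq {e e' : AFEnd X}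
    {D : InitialDataSet (𝓡 3) X} {α : ℝ}
    (h : ∀ᶠ z in cobounded E3, e.dataChartExt =ᶠ[𝓝 z] e'.dataChartExt)
    (hAF : e.IsAsymptoticallyFlat D α) : e'.IsAsymptoticallyFlat D α := by
  obtain ⟨R₀, hR₀⟩ : ∃ R₀ : ℝ, ∀ x : E3, R₀ ≤ ‖x‖ → e.dataChartExt =ᶠ[𝓝 x] e'.dataChartExt := by
    rw [← comap_norm_atTop, eventually_comap, eventually_atTop] at h
    obtain ⟨R₂, hR⟩ := h
    exact ⟨R₂, fun x hx ↦ hR ‖x‖ hx x rfl⟩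
  set R₁ : ℝ := max R₀ (max e.R e'.R) with hR₁
  have hS : IsOpen {w : E3 | R₁ < ‖w‖} := isOpen_lt continuous_const continuous_norm
  have hR₁e : ∀ {w : E3}, R₁ < ‖w‖ → e.R < ‖w‖ := fun hw ↦
    ((le_max_left _ _).trans (le_max_right R₀ _)).trans_lt hw
  have hR₁e' : ∀ {w : E3}, R₁ < ‖w‖ → e'.R < ‖w‖ := fun hw ↦
    ((le_max_right _ _).trans (le_max_right R₀ _)).trans_lt hw
  have hR₁₀ : ∀ {w : E3}, R₁ < ‖w‖ → R₀ ≤ ‖w‖ := fun hw ↦ ((le_max_left _ _).trans_lt hw).le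
  have hh : ∀ z : E3, R₁ < ‖z‖ →
      (fun y ↦ hCoeff e D y - (innerSL ℝ : E3 →L[ℝ] E3 →L[ℝ] ℝ)) =ᶠ[𝓝 z]
        fun y ↦ hCoeff e' D y - (innerSL ℝ : E3 →L[ℝ] E3 →L[ℝ] ℝ) := by
    intro z hz
    filter_upwards [hS.mem_nhds hz] with w hw
    rw [hCoeff_eq_of_dataChartExt_eventuallyEq D (hR₁e hw) (hR₁e' hw) (hR₀ w (hR₁₀ hw))]
  have hk : ∀ z : E3, R₁ < ‖z‖ → kCoeff e D =ᶠ[𝓝 z] kCoeff e' D := by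
    intro z hz
    filter_upwards [hS.mem_nhds hz] with w hw
    exact kCoeff_eq_of_dataChartExt_eventuallyEq D (hR₁e hw) (hR₁e' hw) (hR₀ w (hR₁₀ hw))
  have hev : ∀ᶠ z in cobounded E3, R₁ < ‖z‖ := by
    filter_upwards [eventually_cobounded_le_norm (E := E3) (R₁ + 1)] with z hz
    linarith
  refine ⟨fun m hm ↦ (hAF.1 m hm).congr' ?_ EventuallyEq.rfl,
    fun m hm ↦ (hAF.2 m hm).congr' ?_ EventuallyEq.rfl⟩
  · filter_upwards [hev] with z hz
    rw [((hh z hz).iteratedFDeriv ℝ m).eq_of_nhds]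
  · filter_upwards [hev] with z hz
    rw [((hk z hz).iteratedFDeriv ℝ m).eq_of_nhds]

end AFEnd

namespace Kerr

/-! ### The far end of the Kerr–Schild slice beyond the ergoregion -/

/-- The inner coordinate radius `R_T = R + 2M` (`R = Kerr.afRadius a r₀ = √((max r₀ 0)² + a²) + 1`)
of the far end used to define the asymptotic region `M_ext` of the Kerr black hole: beyond it the
stationary Killing field `∂_{t*}` is timelike (`‖y‖ > R_T > |a| + 2M` forces `r > 2M`, hence
`2H ≤ 2M/r < 1` and `g(∂_{t*}, ∂_{t*}) = −1 + 2H < 0`), i.e. the end lies outside the ergoregion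
`{r² + a² cos²θ < 2Mr} ⊆ {r < 2M}`. O'Neill 1995, Ch. 2, §2.4 (the ergosphere `r = M + √(M² − a² cos²θ) ≤ 2M`);
Chruściel–Costa, Astérisque 321 (2008), §2.1 (`X₀` timelike on `Σ_ext`). [cite: ONeill1995, Ch. 2 §2.4] -/
def stationaryRadius (M a r₀ : ℝ) : ℝ := afRadius a r₀ + 2 * M

/-- `R ≤ R_T` for `M ≥ 0` (O'Neill 1995, Ch. 2, §2.4). [cite: ONeill1995, Ch. 2 §2.4] -/
theorem afRadius_le_stationaryRadius {M : ℝ} (hM : 0 ≤ M) (a r₀ : ℝ) :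
    afRadius a r₀ ≤ stationaryRadius M a r₀ := by
  unfold stationaryRadius
  linarith

/-- `0 < R_T` for `M ≥ 0` (O'Neill 1995, Ch. 2, §2.4). [cite: ONeill1995, Ch. 2 §2.4] -/
theorem stationaryRadius_pos {M : ℝ} (hM : 0 ≤ M) (a r₀ : ℝ) : 0 < stationaryRadius M a r₀ :=
  (afRadius_pos a r₀).trans_le (afRadius_le_stationaryRadius hM a r₀)

/-- `|a| + 2M < R_T`: the far end lies beyond the coordinate sphere `‖y‖ = |a| + 2M`, outside
which `r > 2M` (O'Neill 1995, Ch. 2, §2.4). [cite: ONeill1995, Ch. 2 §2.4] -/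
theorem abs_add_two_mul_lt_stationaryRadius (M a r₀ : ℝ) : |a| + 2 * M < stationaryRadius M a r₀ := by
  unfold stationaryRadius
  linarith [abs_lt_afRadius a r₀]

/-- Points beyond `R_T` belong to the slice (they are beyond `R`, `Kerr.mem_slice_of_lt_norm`).
Dafermos–Rodnianski arXiv:0811.0354, §5.1. [cite: arXiv08110354, §5.1] -/
theorem mem_slice_of_stationaryRadius_lt {M : ℝ} (hM : 0 ≤ M) {a r₀ : ℝ} {y : E3}
    (hy : stationaryRadius M a r₀ < ‖y‖) : y ∈ slice a r₀ :=
  mem_slice_of_lt_norm ((afRadius_le_stationaryRadius hM a r₀).trans_lt hy)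

/-- The **far end** `Σ_ext = {y ∈ Kerr.slice a r₀ | R_T < ‖y‖}` of the Kerr–Schild slice, with the
tautological chart onto `{x : E3 | R_T < ‖x‖}` (an `inclusionAFEnd`): the asymptotically flat end
on whose stationary orbit `M_ext = ⋃ₜ φₜ(Σ_ext)` the Killing field `∂_{t*}` is timelike. It
describes the same end as `Kerr.afEnd a r₀` (only the inner radius is larger). Chruściel–Costa,
Astérisque 321 (2008), §2.1 (`Σ_ext`, (2.1)); Bartnik, CPAM 39 (1986), §1. [cite: ChruscielCosta2008, §2.1] -/
def farEnd (M a r₀ : ℝ) (hM : 0 ≤ M) : AFEnd (slice a r₀) :=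
  inclusionAFEnd (slice a r₀) (stationaryRadius M a r₀) (stationaryRadius_pos hM a r₀)
    fun _ hy ↦ mem_slice_of_stationaryRadius_lt hM hy

/-- The inner radius of the far end is `R_T` (by `rfl`). [cite: ChruscielCosta2008, §2.1] -/
@[simp]
theorem farEnd_R {M : ℝ} (hM : 0 ≤ M) (a r₀ : ℝ) : (farEnd M a r₀ hM).R = stationaryRadius M a r₀ :=
  rfl

/-- The inverse chart of the far end is the identity on coordinates. [cite: Bartnik1986, §1] -/
@[simp]
theorem coe_dataChart_farEnd {M : ℝ} (hM : 0 ≤ M) (a r₀ : ℝ)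
    (z : exteriorRegion (farEnd M a r₀ hM).R) : ((farEnd M a r₀ hM).dataChart z : E3) = z :=
  rfl

/-- The inverse chart of `Kerr.afEnd` is the identity on coordinates. [cite: Bartnik1986, §1] -/
@[simp]
theorem coe_dataChart_afEnd (a r₀ : ℝ) (z : exteriorRegion (afEnd a r₀).R) :
    ((afEnd a r₀).dataChart z : E3) = z :=
  rfl

/-- The far regions of the far end: for `R' ≥ R_T`, `Σ_ext(R') = {y ∈ slice | R' < ‖y‖}`.
Bartnik 1986, §1 (the sets `E_R`). [cite: Bartnik1986, §1] -/
theorem mem_far_farEnd_iff {M : ℝ} (hM : 0 ≤ M) {a r₀ R' : ℝ} (hR' : stationaryRadius M a r₀ ≤ R')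
    {y : slice a r₀} : y ∈ (farEnd M a r₀ hM).far R' ↔ R' < ‖(y : E3)‖ := by
  constructor
  · rintro ⟨u, hu, rfl⟩
    exact hu
  · intro hy
    exact ⟨⟨y, hR'.trans_lt hy⟩, hy, rfl⟩

/-- `Kerr.afEnd` and `Kerr.farEnd` have the same extended inverse chart beyond `R_T` (both are the
inclusion of `{R_T < ‖z‖}` into the slice), locally around every point far out.
Bartnik 1986, §1. [cite: Bartnik1986, §1] -/
theorem dataChartExt_afEnd_eventuallyEq_farEnd {M : ℝ} (hM : 0 ≤ M) (a r₀ : ℝ) :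
    ∀ᶠ z in cobounded E3, (afEnd a r₀).dataChartExt =ᶠ[𝓝 z] (farEnd M a r₀ hM).dataChartExt := by
  have hS : IsOpen {w : E3 | stationaryRadius M a r₀ < ‖w‖} :=
    isOpen_lt continuous_const continuous_norm
  filter_upwards [eventually_cobounded_le_norm (E := E3) (stationaryRadius M a r₀ + 1)] with z hz
  have hz' : stationaryRadius M a r₀ < ‖z‖ := by linarith
  filter_upwards [hS.mem_nhds hz'] with w hw
  have hw' : afRadius a r₀ < ‖w‖ := (afRadius_le_stationaryRadius hM a r₀).trans_lt hw
  rw [(afEnd a r₀).dataChartExt_of_lt hw', (farEnd M a r₀ hM).dataChartExt_of_lt hw]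
  rfl

/-- **The Kerr data are asymptotically flat of order `1` on the far end** `Kerr.farEnd`, given the
named fact `Kerr.isAsymptoticallyFlat_data` (asymptotic flatness on `Kerr.afEnd`, hypothesis
`hAF`): the two end structures differ only in the inner radius. Bartnik 1986, Def. 2.1;
Chruściel–Costa, Astérisque 321 (2008), §2.1. [cite: Bartnik1986, Def. 2.1] -/
theorem isAsymptoticallyFlat_farEnd [Facts] [SliceFacts] {M : ℝ} (hM : 0 ≤ M) (a r₀ : ℝ)
    (hAF : isAsymptoticallyFlat_data M a r₀) :
    (farEnd M a r₀ hM).IsAsymptoticallyFlat (data M a r₀ hM) 1 :=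
  (hAF hM).of_dataChartExt_eventuallyEq (dataChartExt_afEnd_eventuallyEq_farEnd hM a r₀)

/-! ### Time translations: the integral curves and orbits of `∂_{t*}` -/

/-- Time translation `x ↦ x + t ∂_{t*}` preserves the chart domain `Kerr.region a r₀` (`r` does
not depend on `t*`). Dafermos–Rodnianski arXiv:0811.0354, §5.1. [cite: arXiv08110354, §5.1] -/
theorem add_smul_basisVector_zero_mem_region {a r₀ : ℝ} {x : E4} (hx : x ∈ region a r₀) (t : ℝ) :
    x + t • E4.basisVector 0 ∈ region a r₀ := by
  rw [mem_region, radius_add_time_smul_basisVector]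
  exact hx

/-- The **time translate** `φₜ(x) = x + t ∂_{t*}` of a point of the Kerr chart: the flow of the
stationary Killing field `∂_{t*}`. O'Neill 1995, Ch. 2, §2.2; Chruściel–Costa, Astérisque 321
(2008), (2.1) (`φₜ`). [cite: ONeill1995, Ch. 2 §2.2] -/
def timeCurve (a r₀ : ℝ) (x : region a r₀) (t : ℝ) : region a r₀ :=
  ⟨(x : E4) + t • E4.basisVector 0, add_smul_basisVector_zero_mem_region x.2 t⟩

/-- `φₜ(x) = x + t ∂_{t*}` in coordinates (by `rfl`). [cite: ONeill1995, Ch. 2 §2.2] -/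
@[simp]
theorem coe_timeCurve (a r₀ : ℝ) (x : region a r₀) (t : ℝ) :
    (timeCurve a r₀ x t : E4) = x + t • E4.basisVector 0 :=
  rfl

/-- `φ₀ = id`. [cite: ONeill1995, Ch. 2 §2.2] -/
@[simp]
theorem timeCurve_zero (a r₀ : ℝ) (x : region a r₀) : timeCurve a r₀ x 0 = x :=
  Subtype.ext (by simp)

/-- `(0, y) + t ∂_{t*} = (t, y)`. [cite: arXiv08110354, §5.1] -/
theorem _root_.Literature.Geometry.Lorentzian.E4.ofTimeSpace_zero_add_smul (y : E3) (t : ℝ) :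
    E4.ofTimeSpace 0 y + t • E4.basisVector 0 = E4.ofTimeSpace t y := by
  ext i
  refine Fin.cases ?_ (fun j ↦ ?_) i
  · simp
  · simp [Fin.succ_ne_zero]

/-- **The time translates are the integral curves of `∂_{t*}`**: `t ↦ φₜ(x)` is a (whole-line)
integral curve of `Kerr.stationaryField` through `x` (its coordinate expression `t ↦ x + t ∂_{t*}`
has derivative `∂_{t*}`; derivatives of maps into the open submanifold `Kerr.region a r₀ ⊆ E4` are
those of the coordinate expression, `OpensChart.hasMFDerivAt_codRestrict`). O'Neill 1983, Ch. 1,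
Def. 1.46 ff.; O'Neill 1995, Ch. 2, §2.2. [cite: ONeill1995, Ch. 2 §2.2] -/
theorem isMIntegralCurve_timeCurve (a r₀ : ℝ) (x : region a r₀) :
    IsMIntegralCurve (timeCurve a r₀ x) (stationaryField a r₀) := by
  intro t
  have h1 : HasDerivAt (fun s : ℝ ↦ (x : E4) + s • E4.basisVector 0) (E4.basisVector 0) t := by
    simpa using ((hasDerivAt_id t).smul_const (E4.basisVector 0)).const_add (x : E4)
  have h2 : HasMFDerivAt 𝓘(ℝ, ℝ) 𝓘(ℝ, E4) (fun s : ℝ ↦ (x : E4) + s • E4.basisVector 0) t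
      ((1 : ℝ →L[ℝ] ℝ).smulRight (E4.basisVector 0)) :=
    hasMFDerivAt_iff_hasFDerivAt.2 h1.hasFDerivAt
  exact OpensChart.hasMFDerivAt_codRestrict (fun _ ↦ rfl) h2

/-- **`∂_{t*}` is a complete vector field** on every Kerr chart domain: its flow is the globally
defined time translation. O'Neill 1983, Ch. 9, p. 254; Chruściel–Costa, Astérisque 321 (2008),
§2.1 (completeness of `X₀`). [cite: ChruscielCosta2008, §2.1] -/
theorem isCompleteVectorField_stationaryField (a r₀ : ℝ) :
    IsCompleteVectorField (stationaryField a r₀) := fun x ↦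
  ⟨timeCurve a r₀ x, isMIntegralCurve_timeCurve a r₀ x, timeCurve_zero a r₀ x⟩

/-- **Every integral curve of `∂_{t*}` is a time translate**: along a whole-line integral curve
`γ` of `Kerr.stationaryField`, `γ(t) = γ(0) + t ∂_{t*}` in coordinates (the inclusion
`Kerr.region a r₀ ⊆ E4` has identity differential, so `t ↦ γ(t)` has derivative `∂_{t*}` in `E4`;
`Literature.Geometry.Manifold.apply_integralCurve_eq_add_smul`). O'Neill 1983, Ch. 1, Def. 1.46 ff.
(uniqueness of integral curves). [cite: ONeill1983, Ch. 1 Def. 1.46 ff.] -/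
theorem coe_eq_of_isMIntegralCurve_stationaryField {a r₀ : ℝ} {γ : ℝ → region a r₀}
    (hγ : IsMIntegralCurve γ (stationaryField a r₀)) (t : ℝ) :
    (γ t : E4) = (γ 0 : E4) + t • E4.basisVector 0 := by
  have h := Literature.Geometry.Manifold.apply_integralCurve_eq_add_smul (I := 𝓘(ℝ, E4))
    (M := region a r₀) (g := (Subtype.val : region a r₀ → E4)) (V := stationaryField a r₀)
    (c := E4.basisVector 0) contMDiff_subtype_val
    (fun x ↦ by rw [mfderiv_subtypeVal]; rfl) isOpen_univ Set.ordConnected_univ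
    (hγ.isMIntegralCurveOn _) (mem_univ 0) (mem_univ t)
  simpa using h

/-- Every integral curve of `∂_{t*}` is the time translation of its initial point.
O'Neill 1983, Ch. 1, Def. 1.46 ff. [cite: ONeill1983, Ch. 1 Def. 1.46 ff.] -/
theorem eq_timeCurve_of_isMIntegralCurve {a r₀ : ℝ} {γ : ℝ → region a r₀}
    (hγ : IsMIntegralCurve γ (stationaryField a r₀)) (t : ℝ) :
    γ t = timeCurve a r₀ (γ 0) t :=
  Subtype.ext (coe_eq_of_isMIntegralCurve_stationaryField hγ t)

/-- **The stationary orbit of a set is the union of its time translates**: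
`⋃ₜ φₜ(A) = {φₜ(x) | x ∈ A, t ∈ ℝ}` for the flow of `∂_{t*}`. Chruściel–Costa, Astérisque 321
(2008), (2.1). [cite: ChruscielCosta2008, (2.1)] -/
theorem mem_stationaryOrbit_stationaryField_iff {a r₀ : ℝ} {A : Set (region a r₀)}
    {y : region a r₀} :
    y ∈ stationaryOrbit (stationaryField a r₀) A ↔ ∃ x ∈ A, ∃ t : ℝ, timeCurve a r₀ x t = y := by
  constructor
  · rintro ⟨γ, hγ, h0, t, rfl⟩
    exact ⟨γ 0, h0, t, (eq_timeCurve_of_isMIntegralCurve hγ t).symm⟩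
  · rintro ⟨x, hx, t, rfl⟩
    exact ⟨timeCurve a r₀ x, isMIntegralCurve_timeCurve a r₀ x,
      by rwa [timeCurve_zero], t, rfl⟩

/-- The velocity of a time translate is `∂_{t*}`. [cite: ONeill1995, Ch. 2 §2.2] -/
theorem velocity_timeCurve (a r₀ : ℝ) (x : region a r₀) (t : ℝ) :
    velocity 𝓘(ℝ, E4) (timeCurve a r₀ x) t = E4.basisVector 0 := by
  rw [velocity, (isMIntegralCurve_timeCurve a r₀ x t).mfderiv]
  change ((1 : ℝ →L[ℝ] ℝ).smulRight (E4.basisVector 0)) (1 : ℝ) = E4.basisVector 0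
  rw [ContinuousLinearMap.smulRight_apply, one_apply_eq_self, one_smul]

/-! ### `∂_{t*}` is timelike beyond the ergoregion -/

/-- **Beyond `R_T` the stationary field is timelike**: `‖y‖ > R_T` forces `r(0, y) > 2M`
(`‖y‖ ≤ r + |a|`, `Kerr.norm_le_radius_add_abs`), hence `2H ≤ 2M/r < 1`. O'Neill 1995, Ch. 2,
§2.4 (the ergosphere lies in `r ≤ 2M`). [cite: ONeill1995, Ch. 2 §2.4] -/
theorem two_mul_scalarH_lt_one {M : ℝ} (hM : 0 ≤ M) {a r₀ : ℝ} {y : E3}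
    (hy : stationaryRadius M a r₀ < ‖y‖) : 2 * scalarH M a (E4.ofTimeSpace 0 y) < 1 := by
  have hmem : y ∈ slice a r₀ := mem_slice_of_stationaryRadius_lt hM hy
  have hr : 0 < radius a (E4.ofTimeSpace 0 y) :=
    radius_pos_of_mem_region (mem_slice_iff_ofTimeSpace_mem_region.1 hmem)
  have h1 : |a| + 2 * M < ‖y‖ := (abs_add_two_mul_lt_stationaryRadius M a r₀).trans hy
  have h2 : ‖y‖ ≤ radius a (E4.ofTimeSpace 0 y) + |a| := norm_le_radius_add_abs hr
  have h3 : 2 * M < radius a (E4.ofTimeSpace 0 y) := by linarith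
  have h4 : M / radius a (E4.ofTimeSpace 0 y) < 1 / 2 := by
    rw [div_lt_iff₀ hr]
    linarith
  linarith [scalarH_le_div hM a hr]

/-- **`∂_{t*}` is future-directed timelike on the stationary orbit of the far end**: at every
time translate `φₜ(0, y)` of a point `y` of the slice with `‖y‖ > R_T`, the vector `∂_{t*}` is
timelike (`g(∂_{t*}, ∂_{t*}) = −1 + 2H(0, y) < 0`, the components being `t*`-independent) and
future-directed (`g(V, ∂_{t*}) = −dt*(∂_{t*}) = −1 < 0` for the orienting field `V = −g♯dt*`).
Chruściel–Costa, Astérisque 321 (2008), §2.1 (`X₀` timelike on `M_ext`); O'Neill 1995, Ch. 2,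
§2.4. [cite: ChruscielCosta2008, §2.1] -/
theorem isTimelike_stationaryField_timeCurve [Facts] {M : ℝ} (hM : 0 ≤ M) {a r₀ : ℝ}
    (y : slice a r₀) (hy : stationaryRadius M a r₀ < ‖(y : E3)‖) (t : ℝ) :
    (smoothMetric M a r₀).IsTimelike
        (stationaryField a r₀ (timeCurve a r₀ (sliceEmbed a r₀ y) t)) ∧
      ((timeOrientation M a r₀ hM).ofLE le_top : TimeOrientation (smoothMetric M a r₀)).IsFutureDirected
        (stationaryField a r₀ (timeCurve a r₀ (sliceEmbed a r₀ y) t)) := by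
  set p := timeCurve a r₀ (sliceEmbed a r₀ y) t with hp_def
  have hp : (p : E4) = E4.ofTimeSpace 0 (y : E3) + t • E4.basisVector 0 := rfl
  have hr : 0 < radius a (p : E4) := radius_pos_of_mem_region p.2
  have hlt : bilin M a (p : E4) (E4.basisVector 0) (E4.basisVector 0) < 0 := by
    rw [hp, bilin_add_smul_basisVector_zero, bilin_basisVector_zero_basisVector_zero]
    linarith [two_mul_scalarH_lt_one hM hy]
  have hne : (E4.basisVector 0 : E4) ≠ 0 := fun h ↦ by
    simpa using congrArg (fun v : E4 ↦ v 0) h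
  have hV : bilin M a (p : E4) (timeVector M a (p : E4)) (E4.basisVector 0) < 0 := by
    rw [bilin_timeVector hr]
    simp
  exact ⟨hlt, ⟨hlt.le, hne⟩, hV⟩

/-! ### `∂_{t*}` is a Killing field of the smooth Kerr metric -/

/-- **`∂_{t*}` is a Killing field of the (`C^∞`) Kerr metric** `Kerr.smoothMetric M a r₀`, the
metric of the bundled spacetime `Kerr.spacetime M a r₀ hM`, under its standing Levi-Civita
hypothesis: the constant section is smooth and the Killing equation
`g(∇_{Y₀} ∂_t, Z₀) + g(Y₀, ∇_{Z₀} ∂_t) = 0` reduces through `OpensChart.leviCivita_const_apply` and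
the Koszul form to stationarity `∂_{t*} g = 0` of the components
(`Kerr.fderiv_bilin_basisVector_zero`). This is the `C^∞` twin of the discharge
`Kerr.isKillingField_stationaryField_holds` of the named fact `Kerr.isKillingField_stationaryField`
(stated for the analytic metric `Kerr.metric`). O'Neill 1983, Ch. 9, Prop. 9.25; O'Neill 1995,
Ch. 2, §2.2. [cite: ONeill1983, Ch. 9, Prop. 9.25] -/
theorem isKillingField_stationaryField_smoothMetric [Facts] (M a r₀ : ℝ)
    [(smoothMetric M a r₀).HasLeviCivita] :
    (smoothMetric M a r₀).toPseudoRiemannianMetric.IsKillingField (stationaryField a r₀) := by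
  refine ⟨fun x ↦ ?_, fun x Y₀ Z₀ ↦ ?_⟩
  · rw [ModelWithCorners.tangent, OpensChart.contMDiffAt_section_iff x (stationaryField a r₀)]
    exact contMDiffAt_const
  · have hG : ∀ y : region a r₀,
        (smoothMetric M a r₀).toPseudoRiemannianMetric.val y = bilin M a y := fun y ↦ rfl
    have hGx := differentiableAt_bilin M a x
    have hlc : ∀ W : E4,
        (smoothMetric M a r₀).toPseudoRiemannianMetric.leviCivita (stationaryField a r₀) x W =
          OpensChart.christoffel (smoothMetric M a r₀).toPseudoRiemannianMetric (bilin M a) x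
            (E4.basisVector 0) W :=
      fun W ↦ OpensChart.leviCivita_const_apply hG x hGx (E4.basisVector 0) W
    rw [hlc, hlc, (smoothMetric M a r₀).symm x Y₀]
    have h2 := OpensChart.two_mul_val_christoffel
      (g := (smoothMetric M a r₀).toPseudoRiemannianMetric) (G := bilin M a) x (E4.basisVector 0)
      Y₀ Z₀
    have h3 := OpensChart.two_mul_val_christoffel
      (g := (smoothMetric M a r₀).toPseudoRiemannianMetric) (G := bilin M a) x (E4.basisVector 0)
      Z₀ Y₀
    simp only [OpensChart.koszulForm_apply, fderiv_bilin_basisVector_zero M a hGx,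
      zero_apply] at h2 h3
    have h4 := fderiv_bilin_symm M a hGx Y₀ (E4.basisVector 0) Z₀
    have h5 := fderiv_bilin_symm M a hGx Z₀ (E4.basisVector 0) Y₀
    linarith

/-! ### The slice embedding is a smooth embedding (discharge of `Kerr.isSmoothEmbedding_sliceEmbed`) -/

/-- The slice embedding `y ↦ (0, y)` is continuous. Dafermos–Rodnianski arXiv:0811.0354, §5.1.
[cite: arXiv08110354, §5.1] -/
theorem continuous_sliceEmbed (a r₀ : ℝ) : Continuous (sliceEmbed a r₀) :=
  (contMDiff_sliceEmbed a r₀ 0).continuous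

/-- The slice embedding is a **topological embedding** (a homeomorphism onto its image): its
composite with the inclusion `Kerr.region a r₀ ⊆ E4` is `y ↦ (0, y)` restricted to the open
subset `slice ⊆ E3`, which has the continuous left inverse `E4.spatial`. Hawking–Ellis 1973,
§2.3, p. 23 (imbeddings); Dafermos–Rodnianski arXiv:0811.0354, §5.1. [cite: HawkingEllis1973, §2.3 p. 23] -/
theorem isEmbedding_sliceEmbed (a r₀ : ℝ) : Topology.IsEmbedding (sliceEmbed a r₀) := by
  have h0 : Topology.IsEmbedding (E4.ofTimeSpace 0) :=
    Topology.IsEmbedding.of_leftInverse (f := E4.spatial) (fun y ↦ E4.spatial_ofTimeSpace 0 y)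
      E4.spatial.continuous (E4.continuous_ofTimeSpace 0)
  have h1 : Topology.IsEmbedding (Subtype.val ∘ sliceEmbed a r₀) :=
    h0.comp Topology.IsEmbedding.subtypeVal
  exact Topology.IsEmbedding.of_comp (continuous_sliceEmbed a r₀) continuous_subtype_val h1

/-- The slice embedding `y ↦ (0, y)` of `Kerr.slice a r₀` into `Kerr.region a r₀` is a `C^∞`
**immersion** in the chart sense (Mathlib's `Manifold.IsImmersion`; Hawking–Ellis 1973, §2.3,
p. 23): with respect to the complement `F = ℝ` and the linear isomorphism `E3 × ℝ ≅ E4`,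
`(y, t) ↦ (t, y)`, it reads `u ↦ (u, 0)` in the preferred charts of the open submanifolds
`slice ⊆ E3` and `region ⊆ E4` (restrictions of the identity charts). Same argument as
`Minkowski.isImmersion_sliceEmbed` (`ModelData.lean`). [cite: HawkingEllis1973, §2.3 p. 23] -/
theorem isImmersion_sliceEmbed (a r₀ : ℝ) :
    Manifold.IsImmersion 𝓘(ℝ, E3) 𝓘(ℝ, E4) ∞ (sliceEmbed a r₀) := by
  -- the linear isomorphism `(y, t) ↦ (t, y) : E3 × ℝ ≅ E4` (continuous: finite dimension)
  let eₗ : (E3 × ℝ) ≃ₗ[ℝ] E4 :=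
    { toFun := fun p ↦ E4.ofTimeSpace p.2 p.1
      map_add' := fun p q ↦ E4.ofTimeSpace_add p.2 q.2 p.1 q.1
      map_smul' := fun c p ↦ E4.ofTimeSpace_smul c p.2 p.1
      invFun := fun v ↦ (E4.spatial v, E4.time v)
      left_inv := fun p ↦ by simp
      right_inv := fun v ↦ E4.ofTimeSpace_time_spatial v }
  let e : (E3 × ℝ) ≃L[ℝ] E4 := eₗ.toContinuousLinearEquiv
  have he : ∀ p : E3 × ℝ, e p = E4.ofTimeSpace p.2 p.1 := fun _ ↦ rfl
  refine ⟨ℝ, inferInstance, inferInstance, fun x ↦ ?_⟩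
  refine Manifold.IsImmersionAtOfComplement.mk_of_continuousAt
    (continuous_sliceEmbed a r₀).continuousAt e (chartAt E3 x) (chartAt E4 (sliceEmbed a r₀ x))
    (mem_chart_source E3 x) (mem_chart_source E4 (sliceEmbed a r₀ x))
    (IsManifold.chart_mem_maximalAtlas x) (IsManifold.chart_mem_maximalAtlas (sliceEmbed a r₀ x)) ?_
  intro z hz
  -- `z` lies in the target of the preferred chart of `slice` at `x`
  have hz' : z ∈ (chartAt E3 x).target := by
    rw [OpenPartialHomeomorph.extend_target] at hz
    exact hz.1
  -- the inverse chart of the open submanifold `slice` is the identity on coordinates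
  have key : (((chartAt E3 x).symm z : slice a r₀) : E3) = z := by
    have h := (chartAt E3 (x : E3)).subtypeRestr_symm_apply ⟨x⟩ hz'
    rw [chartAt_self_eq, OpenPartialHomeomorph.refl_symm] at h
    exact h
  calc ((chartAt E4 (sliceEmbed a r₀ x)).extend 𝓘(ℝ, E4))
        (sliceEmbed a r₀ (((chartAt E3 x).extend 𝓘(ℝ, E3)).symm z))
      = (sliceEmbed a r₀ ((chartAt E3 x).symm z) : E4) := rfl
    _ = E4.ofTimeSpace 0 z := by rw [coe_sliceEmbed, key]
    _ = e (z, 0) := (he (z, 0)).symm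

/-- **Discharge of the named fact `Kerr.isSmoothEmbedding_sliceEmbed`**: the slice embedding
`y ↦ (0, y)` of the Kerr–Schild slice `{t* = 0}` into the Kerr chart is a smooth embedding
(immersion + homeomorphism onto its image). Dafermos–Rodnianski arXiv:0811.0354, §5.1;
Hawking–Ellis 1973, §2.3, p. 23; Lee, *Introduction to Smooth Manifolds*, Thm. 4.12 ff.
[cite: arXiv08110354, §5.1] -/
theorem isSmoothEmbedding_sliceEmbed_holds : ∀ a r₀ : ℝ, isSmoothEmbedding_sliceEmbed a r₀ :=
  fun a r₀ ↦ ⟨isImmersion_sliceEmbed a r₀, isEmbedding_sliceEmbed a r₀⟩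

/-! ### Kerr as a `StationaryAFBlackHole` -/

/-- **The Kerr chart `{r > max r₀ 0}` as a stationary asymptotically flat black-hole spacetime**
(the hypothesis structure `StationaryAFBlackHole` of the uniqueness theorem, `Stationary.lean`),
for mass `M ≥ 0`, specific angular momentum `a` and an arbitrary inner chart radius `r₀`:

* spacetime `Kerr.spacetime M a r₀ hM` — the ingoing Kerr–Schild chart domain `Kerr.region a r₀`
  with `g = η + 2H ℓ ⊗ ℓ`, time-oriented by `−g♯dt*`;
* slice `X = Kerr.slice a r₀` (`{t* = 0}`), data `D = Kerr.data M a r₀ hM` (`h = δ + 2H ℓ⃗ ⊗ ℓ⃗`,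
  `k = K_ν`), embedding `embed = Kerr.sliceEmbed` (`y ↦ (0, y)`), future unit normal
  `normal = Kerr.sliceNormal`;
* asymptotically flat end `e = Kerr.farEnd M a r₀ hM = {‖y‖ > R_T}`, `R_T = R + 2M`, on which the
  data are asymptotically flat of order `1` (the named fact `Kerr.isAsymptoticallyFlat_data`,
  hypothesis `hAF`, transported from `Kerr.afEnd` by `Kerr.isAsymptoticallyFlat_farEnd`);
* stationary Killing field `killing = Kerr.stationaryField = ∂_{t*}`: Killing
  (`isKillingField_stationaryField_smoothMetric`), complete (its flow is the time translation
  `Kerr.timeCurve`), future-directed timelike on `M_ext = ⋃ₜ φₜ(embed(e.far (R_T + 1)))`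
  (`isTimelike_stationaryField_timeCurve`).

All structure fields are proved; the only hypotheses are `0 ≤ M`, the instance hypotheses
`[Kerr.Facts]`, `[Kerr.SliceFacts]` of `Kerr.spacetime`/`Kerr.data` and the named fact `hAF`.
For `r₀ = r₊ − δ`, `0 < δ < r₊ − r₋`, this is the horizon-penetrating chart of the sub-extremal
Kerr black hole (`Kerr.stationaryAFBlackHole`); for `r₀ = r₊` the exterior only.
Dafermos–Rodnianski arXiv:0811.0354, §5.1 (ingoing Kerr–Schild/Kerr-star coordinates, the
slices `{t* = c}`); O'Neill 1995, Ch. 2, §§2.2–2.5; Chruściel–Costa, Astérisque 321 (2008), §2.1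
(the data `(M, g, X₀, Σ_ext)` of a stationary asymptotically flat spacetime). [cite: arXiv08110354, §5.1] -/
def stationaryAFBlackHoleOn [Facts] [SliceFacts] (M a r₀ : ℝ) (hM : 0 ≤ M)
    (hAF : isAsymptoticallyFlat_data M a r₀) : StationaryAFBlackHole where
  toSpacetime := spacetime M a r₀ hM
  X := slice a r₀
  D := data M a r₀ hM
  e := farEnd M a r₀ hM
  isAsymptoticallyFlat := ⟨1, one_pos, isAsymptoticallyFlat_farEnd hM a r₀ hAF⟩
  embed := sliceEmbed a r₀
  normal := sliceNormal M a r₀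
  isSmoothEmbedding := isSmoothEmbedding_sliceEmbed_holds a r₀
  isFutureUnitNormal := isFutureUnitNormal_sliceNormal_holds M a r₀ hM
  induced_h := fun _ ↦ rfl
  induced_k := fun _ ↦ rfl
  killing := stationaryField a r₀
  isStationary := by
    refine ⟨isKillingField_stationaryField_smoothMetric M a r₀,
      isCompleteVectorField_stationaryField a r₀, fun x hx ↦ ?_⟩
    obtain ⟨p, ⟨y, hy, rfl⟩, t, rfl⟩ := mem_stationaryOrbit_stationaryField_iff.1 hx
    have hy' : stationaryRadius M a r₀ + 1 < ‖(y : E3)‖ :=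
      (mem_far_farEnd_iff hM (by linarith)).1 hy
    exact isTimelike_stationaryField_timeCurve hM y (by linarith) t

/-- **The sub-extremal Kerr black hole as a stationary asymptotically flat black-hole spacetime**:
`Kerr.stationaryAFBlackHoleOn M a (r₊ − δ)`, the horizon-penetrating ingoing Kerr–Schild chart
`{r > r₊ − δ}` of the Kerr spacetime with `|a| < M`, with the slice `{t* = 0}`, its induced data,
the far end `{‖y‖ > R_T}` beyond the ergoregion and the Killing field `∂_{t*}`, packaged as a
`StationaryAFBlackHole`. Intended range `0 < δ < r₊ − r₋` (then the chart contains the future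
event horizon `{r = r₊}` and no part of the Cauchy horizon); the construction is valid for every
real `δ` (`δ ≤ 0`: a sub-chart of the exterior). Hypotheses: `[Kerr.Facts]`, `[Kerr.SliceFacts]`
and the named fact `Kerr.isAsymptoticallyFlat_data` (`hAF`). Dafermos–Rodnianski
arXiv:0811.0354, §5.1; O'Neill 1995, Ch. 2, §§2.4–2.5 (Boyer–Lindquist blocks I–II, `r_±`);
Chruściel–Costa, Astérisque 321 (2008), §2.1 and Thm. 1.3 (Kerr is the model of the uniqueness
theorem). [cite: arXiv08110354, §5.1] -/
def stationaryAFBlackHole [Facts] [SliceFacts] (M a δ : ℝ) (hMa : IsSubextremal M a)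
    (hAF : isAsymptoticallyFlat_data M a (rPlus M a - δ)) : StationaryAFBlackHole :=
  stationaryAFBlackHoleOn M a (rPlus M a - δ) hMa.pos.le hAF

/-- The spacetime of the sub-extremal Kerr black hole `Kerr.stationaryAFBlackHole M a δ` is the
Kerr chart with inner radius `r₊ − δ` (by `rfl`). [cite: arXiv08110354, §5.1] -/
@[simp]
theorem stationaryAFBlackHole_toSpacetime [Facts] [SliceFacts] (M a δ : ℝ) (hMa : IsSubextremal M a)
    (hAF : isAsymptoticallyFlat_data M a (rPlus M a - δ)) :
    (stationaryAFBlackHole M a δ hMa hAF).toSpacetime = spacetime M a (rPlus M a - δ) hMa.pos.le :=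
  rfl

/-- `Kerr.stationaryAFBlackHole` is `Kerr.stationaryAFBlackHoleOn` at `r₀ = r₊ − δ` (by `rfl`), so
that all results on the latter apply. [cite: arXiv08110354, §5.1] -/
theorem stationaryAFBlackHole_eq [Facts] [SliceFacts] (M a δ : ℝ) (hMa : IsSubextremal M a)
    (hAF : isAsymptoticallyFlat_data M a (rPlus M a - δ)) :
    stationaryAFBlackHole M a δ hMa hAF = stationaryAFBlackHoleOn M a (rPlus M a - δ) hMa.pos.le hAF :=
  rfl

section API

variable [Facts] [SliceFacts] {M : ℝ} (hM : 0 ≤ M) (a r₀ : ℝ) (hAF : isAsymptoticallyFlat_data M a r₀)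

/-- The spacetime of `Kerr.stationaryAFBlackHoleOn` is the Kerr chart `Kerr.spacetime` (by `rfl`).
[cite: arXiv08110354, §5.1] -/
@[simp]
theorem stationaryAFBlackHoleOn_toSpacetime :
    (stationaryAFBlackHoleOn M a r₀ hM hAF).toSpacetime = spacetime M a r₀ hM :=
  rfl

/-- The Killing field of `Kerr.stationaryAFBlackHoleOn` is `∂_{t*}` (by `rfl`). [cite: ONeill1995, Ch. 2 §2.2] -/
@[simp]
theorem stationaryAFBlackHoleOn_killing :
    (stationaryAFBlackHoleOn M a r₀ hM hAF).killing = stationaryField a r₀ :=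
  rfl

/-- The slice embedding of `Kerr.stationaryAFBlackHoleOn` is `y ↦ (0, y)` (by `rfl`).
[cite: arXiv08110354, §5.1] -/
@[simp]
theorem stationaryAFBlackHoleOn_embed :
    (stationaryAFBlackHoleOn M a r₀ hM hAF).embed = sliceEmbed a r₀ :=
  rfl

/-- The data of `Kerr.stationaryAFBlackHoleOn` are the Kerr data (by `rfl`). [cite: arXiv08110354, §5.1] -/
@[simp]
theorem stationaryAFBlackHoleOn_D :
    (stationaryAFBlackHoleOn M a r₀ hM hAF).D = data M a r₀ hM :=
  rfl

/-- The end of `Kerr.stationaryAFBlackHoleOn` is the far end `Kerr.farEnd` (by `rfl`).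
[cite: ChruscielCosta2008, §2.1] -/
@[simp]
theorem stationaryAFBlackHoleOn_e :
    (stationaryAFBlackHoleOn M a r₀ hM hAF).e = farEnd M a r₀ hM :=
  rfl

/-- The unit normal of `Kerr.stationaryAFBlackHoleOn` is `Kerr.sliceNormal` (by `rfl`).
[cite: Cook2000, §3.2.2] -/
@[simp]
theorem stationaryAFBlackHoleOn_normal :
    (stationaryAFBlackHoleOn M a r₀ hM hAF).normal = sliceNormal M a r₀ :=
  rfl

/-- **The asymptotic region of the Kerr black hole**: `M_ext = ⋃ₜ φₜ(Σ_ext(R_T + 1))` is the set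
of chart points whose spatial part lies beyond the coordinate sphere `‖y‖ = R_T + 1`,
`M_ext = {(t*, y) | ‖y‖ > R_T + 1}` (the flow of `∂_{t*}` translates `t*`). Chruściel–Costa,
Astérisque 321 (2008), (2.1). [cite: ChruscielCosta2008, (2.1)] -/
theorem mem_Mext_stationaryAFBlackHoleOn_iff {x : region a r₀} :
    x ∈ (stationaryAFBlackHoleOn M a r₀ hM hAF).Mext ↔
      stationaryRadius M a r₀ + 1 < ‖E4.spatial (x : E4)‖ := by
  change x ∈ stationaryOrbit (stationaryField a r₀)
    (sliceEmbed a r₀ '' (farEnd M a r₀ hM).far (stationaryRadius M a r₀ + 1)) ↔ _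
  rw [mem_stationaryOrbit_stationaryField_iff]
  constructor
  · rintro ⟨p, ⟨y, hy, rfl⟩, t, rfl⟩
    have hy' : stationaryRadius M a r₀ + 1 < ‖(y : E3)‖ :=
      (mem_far_farEnd_iff hM (by linarith)).1 hy
    simpa [spatial_add_smul_basisVector_zero] using hy'
  · intro hx
    have hy : E4.spatial (x : E4) ∈ slice a r₀ :=
      mem_slice_of_stationaryRadius_lt hM (by linarith)
    refine ⟨sliceEmbed a r₀ ⟨E4.spatial (x : E4), hy⟩, ⟨⟨E4.spatial (x : E4), hy⟩,
      (mem_far_farEnd_iff hM (by linarith)).2 hx, rfl⟩, E4.time (x : E4), Subtype.ext ?_⟩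
    rw [coe_timeCurve, coe_sliceEmbed, E4.ofTimeSpace_zero_add_smul, E4.ofTimeSpace_time_spatial]

/-- On the asymptotic region `M_ext` of the Kerr black hole `r > 2M` (in particular `M_ext` lies in
the exterior `{r > r₊}`, as `r₊ ≤ 2M`): `‖y‖ > R_T + 1 > |a| + 2M` and `‖y‖ ≤ r + |a|`.
O'Neill 1995, Ch. 2, §2.4. [cite: ONeill1995, Ch. 2 §2.4] -/
theorem two_mul_lt_radius_of_mem_Mext {x : region a r₀}
    (hx : x ∈ (stationaryAFBlackHoleOn M a r₀ hM hAF).Mext) : 2 * M < radius a (x : E4) := by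
  rw [mem_Mext_stationaryAFBlackHoleOn_iff] at hx
  have hr : 0 < radius a (E4.ofTimeSpace 0 (E4.spatial (x : E4))) := by
    rw [radius_ofTimeSpace_spatial]
    exact radius_pos_of_mem_region x.2
  have h1 : |a| + 2 * M < ‖E4.spatial (x : E4)‖ := by
    linarith [abs_add_two_mul_lt_stationaryRadius M a r₀]
  have h2 := norm_le_radius_add_abs hr
  rw [radius_ofTimeSpace_spatial] at h2
  linarith

/-- On the asymptotic region of the Kerr black hole `r > r₊` (`r > 2M ≥ r₊` for `a² ≤ M²`): `M_ext`
lies in the exterior / Boyer–Lindquist block I. O'Neill 1995, Ch. 2, §§2.3–2.4. [cite: ONeill1995, Ch. 2 §2.4] -/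
theorem rPlus_lt_radius_of_mem_Mext {x : region a r₀}
    (hx : x ∈ (stationaryAFBlackHoleOn M a r₀ hM hAF).Mext) : rPlus M a < radius a (x : E4) :=
  (rPlus_le_two_mul (a := a) hM).trans_lt (two_mul_lt_radius_of_mem_Mext hM a r₀ hAF hx)

/-- The asymptotic region is invariant under the time translations (it is a union of orbits).
Chruściel–Costa, Astérisque 321 (2008), (2.1). [cite: ChruscielCosta2008, (2.1)] -/
theorem timeCurve_mem_Mext {x : region a r₀}
    (hx : x ∈ (stationaryAFBlackHoleOn M a r₀ hM hAF).Mext) (t : ℝ) :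
    timeCurve a r₀ x t ∈ (stationaryAFBlackHoleOn M a r₀ hM hAF).Mext := by
  rw [mem_Mext_stationaryAFBlackHoleOn_iff] at hx ⊢
  simpa [spatial_add_smul_basisVector_zero] using hx

/-- **`M_ext` lies in the domain of outer communications** `⟨⟨M_ext⟩⟩ = I⁺(M_ext) ∩ I⁻(M_ext)` of
the Kerr black hole (pointwise form, for a chart point `x`): through `x ∈ M_ext` passes the orbit
`t ↦ φₜ(x) ⊆ M_ext` of the Killing field, a future-directed timelike curve from `φ₋₁(x)` to `x`,
and reversed a past-directed one from `φ₁(x)` to `x`. Chruściel–Costa, Astérisque 321 (2008),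
§2.2 (`M_ext ⊆ ⟨⟨M_ext⟩⟩`). [cite: ChruscielCosta2008, §2.2] -/
theorem mem_doc_of_mem_Mext (x : region a r₀) (hx : x ∈ (stationaryAFBlackHoleOn M a r₀ hM hAF).Mext) :
    x ∈ (stationaryAFBlackHoleOn M a r₀ hM hAF).doc := by
  -- timelikeness and time orientation of `∂_{t*}` along the orbit of `x`
  have horb : ∀ s : ℝ, (smoothMetric M a r₀).IsTimelike
        (stationaryField a r₀ (timeCurve a r₀ x s)) ∧
      ((timeOrientation M a r₀ hM).ofLE le_top : TimeOrientation (smoothMetric M a r₀)).IsFutureDirected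
        (stationaryField a r₀ (timeCurve a r₀ x s)) := by
    intro s
    have hs := timeCurve_mem_Mext hM a r₀ hAF hx s
    obtain ⟨p, ⟨y, hy, rfl⟩, t, ht⟩ := mem_stationaryOrbit_stationaryField_iff.1 hs
    have hy' := (mem_far_farEnd_iff (a := a) (r₀ := r₀) (y := y) hM
      (le_add_of_nonneg_right zero_le_one)).1 hy
    rw [← ht]
    exact isTimelike_stationaryField_timeCurve hM y (by linarith) t
  have hmd : ∀ s : ℝ, MDifferentiableAt 𝓘(ℝ, ℝ) 𝓘(ℝ, E4) (timeCurve a r₀ x) s := fun s ↦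
    (isMIntegralCurve_timeCurve a r₀ x s).mdifferentiableAt
  -- the reversed orbit `s ↦ φ₋ₛ(x)` has velocity `−∂_{t*}`
  have hmd' : ∀ s : ℝ, HasMFDerivAt 𝓘(ℝ, ℝ) 𝓘(ℝ, E4) (fun s' : ℝ ↦ timeCurve a r₀ x (-s')) s
      ((1 : ℝ →L[ℝ] ℝ).smulRight (-E4.basisVector 0)) := by
    intro s
    have h1 : HasDerivAt (fun s' : ℝ ↦ (x : E4) + (-s') • E4.basisVector 0) (-E4.basisVector 0) s := by
      simpa using (((hasDerivAt_id s).neg).smul_const (E4.basisVector 0)).const_add (x : E4)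
    have h2 : HasMFDerivAt 𝓘(ℝ, ℝ) 𝓘(ℝ, E4) (fun s' : ℝ ↦ (x : E4) + (-s') • E4.basisVector 0) s
        ((1 : ℝ →L[ℝ] ℝ).smulRight (-E4.basisVector 0)) :=
      hasMFDerivAt_iff_hasFDerivAt.2 h1.hasFDerivAt
    exact OpensChart.hasMFDerivAt_codRestrict (fun _ ↦ rfl) h2
  have hvel : ∀ s : ℝ, velocity 𝓘(ℝ, E4) (fun s' : ℝ ↦ timeCurve a r₀ x (-s')) s =
      -E4.basisVector 0 := by
    intro s
    rw [velocity, (hmd' s).mfderiv]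
    change ((1 : ℝ →L[ℝ] ℝ).smulRight (-E4.basisVector 0)) (1 : ℝ) = -E4.basisVector 0
    rw [ContinuousLinearMap.smulRight_apply, one_apply_eq_self, one_smul]
  refine ⟨?_, ?_⟩
  · -- `x ∈ I⁺(M_ext)`: the orbit from `φ₋₁(x)` to `x`
    refine ⟨timeCurve a r₀ x (-1), timeCurve_mem_Mext hM a r₀ hAF hx (-1),
      timeCurve a r₀ x, -1, 0, by norm_num, fun s _ ↦ ⟨hmd s, ?_⟩, rfl, timeCurve_zero a r₀ x⟩
    change (smoothMetric M a r₀).IsTimelike (velocity 𝓘(ℝ, E4) (timeCurve a r₀ x) s) ∧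
      ((timeOrientation M a r₀ hM).ofLE le_top : TimeOrientation (smoothMetric M a r₀)).IsFutureDirected
        (velocity 𝓘(ℝ, E4) (timeCurve a r₀ x) s)
    rw [velocity_timeCurve]
    exact horb s
  · -- `x ∈ I⁻(M_ext)`: the reversed orbit from `φ₁(x)` to `x` is future timelike for `τ.reverse`
    refine ⟨timeCurve a r₀ x 1, timeCurve_mem_Mext hM a r₀ hAF hx 1,
      fun s' : ℝ ↦ timeCurve a r₀ x (-s'), -1, 0, by norm_num,
      fun s _ ↦ ⟨(hmd' s).mdifferentiableAt, ?_⟩, by simp, by simp⟩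
    change (smoothMetric M a r₀).IsTimelike (velocity 𝓘(ℝ, E4) (fun s' : ℝ ↦ timeCurve a r₀ x (-s')) s) ∧
      ((timeOrientation M a r₀ hM).ofLE le_top : TimeOrientation (smoothMetric M a r₀)).reverse.IsFutureDirected
        (velocity 𝓘(ℝ, E4) (fun s' : ℝ ↦ timeCurve a r₀ x (-s')) s)
    rw [hvel s]
    obtain ⟨h1, h2, h4⟩ := horb (-s)
    have e0 : stationaryField a r₀ (timeCurve a r₀ x (-s)) = E4.basisVector 0 := rfl
    rw [e0] at h1 h2 h4
    -- `g(−∂_t, −∂_t) = g(∂_t, ∂_t) < 0` and `g(−V, −∂_t) = g(V, ∂_t) < 0`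
    refine ⟨(LorentzianMetric.isTimelike_neg_iff _ _).2 h1,
      (LorentzianMetric.isCausal_neg_iff _ _).2 h2, ?_⟩
    rw [TimeOrientation.vectorField_reverse]
    have key : ∀ (B : E4 →L[ℝ] E4 →L[ℝ] ℝ) (v w : E4), B (-v) (-w) = B v w := fun B v w ↦ by simp
    exact lt_of_eq_of_lt (key _ _ _) h4

/-- **`M_ext ⊆ ⟨⟨M_ext⟩⟩`** for the Kerr black hole; in particular the domain of outer
communications of `Kerr.stationaryAFBlackHoleOn` is nonempty. Chruściel–Costa, Astérisque 321
(2008), §2.2. [cite: ChruscielCosta2008, §2.2] -/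
theorem Mext_subset_doc :
    (stationaryAFBlackHoleOn M a r₀ hM hAF).Mext ⊆ (stationaryAFBlackHoleOn M a r₀ hM hAF).doc :=
  fun x hx ↦ mem_doc_of_mem_Mext hM a r₀ hAF x hx

end API

end Kerr

end Literature.Geometry.Lorentzian

end
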